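import Summits.BirchSwinnertonDyer.BirchSwinnertonDyer.Theorems.PrintCf2RubinValueTwoAvatarOnRayDegreeOne
import Literature.NumberTheory.PAdicHodge.UnramifiedCompletionEmbedding
import Literature.NumberTheory.ComplexMultiplication.EllipticUnits.ThetaSingularValues
import Mathlib.FieldTheory.Normal.Defs
import HarnessLib

set_option linter.dupNamespace false
set_option autoImplicit false

/-!
# Q-θ: the `p`-adic reading `θ ∘ (K̄ → K̄_v → ℂ_{K_v})` and the complex reading `ι_p⁻¹ ∘ ι̂` of `K̄` agree UP TO ONE
# `τ ∈ Γ_K` (the conjugacy of the two places of `K̄` above `v`) — the named hypothesis `hQθ` of the seam's per-unit assembler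

Cell `bsd-print-cf2`, width seat `bsd-line-cf2-p1-w3` g31; print leaf 24720 `KatzDistributionsAtTwoPrint` (director OPTION 1, `j = 0` twin),
R3 endpoint / `hsupply` / `hseam` (p764079, p764618).  `--supports stmt-BirchSwinnertonDyer-24720` (helper, Theses-free).  THEOREMS ONLY (no
`def`, no named fact, no `sorry`); nothing is closed; no summit statement is proved by this seat; BSD is not proved by any of this.

WHY.  Three independent non-canonical choices meet in the twisted class-sum identity `hsum`: the lane's embedding
`e := absClosureEmbedding K K_v : K̄ →ₐ[K] K̄_v` (`IsAlgClosed.lift`; it defines `RelNormCoherentUnits.ofGlobal`, the towers and the Artin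
lifts), the complex embedding `ι̂ := algClosureEmb σ : K̄ → ℂ` of the elliptic units (II.2 prints, D2's `hx`), and the endpoint's
`ι_p : ℚ̄_p ≃ ℂ`, pinned to `v` on `K` ONLY (`hι`).  The local datum of -w8's D1 carries an ARBITRARY continuous bijective reading
`θ : ℂ_{K_v} → ℂ_p` extending `K_v = ℚ_p`.  A `θ` with `θ ∘ e = ι_p⁻¹ ∘ ι̂` exists only if the two places of `K̄` above `v` cut out by `e`
and by `ι_p⁻¹ ∘ ι̂` coincide — false in general.  WHAT IS TRUE (this file): for EVERY such `θ` there is `τ ∈ Γ_K = Gal(K̄/K)` with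
`θ (e (τ x)) = ι_p⁻¹ (ι̂ x)` for all `x ∈ K̄` (`exists_absGal_reading_conj`) — so the seam's per-unit assembler (-w2 g24 p764661, hypothesis
`hQθ : ρ.comp ψ𝔓 = (↑ ∘ ι_p.symm).comp φC`) takes `φC := ι̂ ∘ τ⁻¹` (resp. reads the `τ`-conjugate data), and the measure side absorbs `τ`
as a translate (`twisting τ 0 μ`).  Ingredients: any two `K`-algebra maps of the normal extension `K̄/K` into a field differ by an
automorphism of `K̄` (Mathlib `AlgHom.restrictNormal'`, §1); on `K` both readings are the canonical `K → K_v = ℚ_p ⊆ ℂ_p` (-w5 g13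
`AvatarOnRay.comp_eq_of_place_eq` from `hι`, and `θ`'s `K_v`-linearity, §2 — the latter from D1's `hΘe` alone, since `ℤ_p` has no ring
endomorphism but the identity, `ringHom_padicInt_eq_id`).

References: [SerreAbelianLadic1968] Ch. II §3.1, Ch. III §1.1; [FrohlichTaylor1990] Ch. III §1 (1.14)(a); [deShalit1987] II.4.7 (p. 60:
"we have fixed an embedding of ℚ̄ into ℂ_p").
-/

noncomputable section

open scoped NumberField
open ValuativeRel
open NumberField IsDedekindDomain Field
open Literature.NumberTheory.GaloisRepresentations Literature.NumberTheory.EllipticCurves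
open Literature.NumberTheory.NumberFields Literature.NumberTheory.PAdicHodge
open Literature.NumberTheory.ComplexMultiplication.EllipticUnits

namespace Summit.BirchSwinnertonDyer.BirchSwinnertonDyer.Theorems.PrintCf2.KatzMeasureJZeroTop

/-! ## §1 Two `K`-algebra maps from a normal extension into a field differ by an automorphism -/

/-- **Any two `F`-algebra maps `E → L` of a normal extension `E/F` into a field `L` differ by an `F`-automorphism of `E`**:
`∃ τ, φ₁ ∘ τ = φ₂` (Mathlib's `AlgHom.restrictNormal'` applied to `id : L → L` for the two `E`-algebra structures).
[cite: SerreAbelianLadic1968, Ch. III §1.1] -/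
theorem exists_algEquiv_forall_apply_eq {F E L : Type*} [Field F] [Field E] [Field L] [Algebra F E] [Normal F E]
    [Algebra F L] (φ₁ φ₂ : E →ₐ[F] L) : ∃ τ : E ≃ₐ[F] E, ∀ x : E, φ₁ (τ x) = φ₂ x := by
  let A₁ : Algebra E L := φ₂.toRingHom.toAlgebra
  let A₂ : Algebra E L := φ₁.toRingHom.toAlgebra
  have T₁ : @IsScalarTower F E L _ A₁.toSMul _ :=
    @IsScalarTower.of_algebraMap_eq F E L _ _ _ _ A₁ _ fun x ↦ (φ₂.commutes x).symm
  have T₂ : @IsScalarTower F E L _ A₂.toSMul _ :=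
    @IsScalarTower.of_algebraMap_eq F E L _ _ _ _ A₂ _ fun x ↦ (φ₁.commutes x).symm
  refine ⟨@AlgHom.restrictNormal' F _ L L _ _ _ _ (AlgHom.id F L) E _ _ A₁ A₂ T₁ T₂ _, fun x ↦ ?_⟩
  have h := @AlgHom.restrictNormal_commutes F _ L L _ _ _ _ (AlgHom.id F L) E _ _ A₁ A₂ T₁ T₂ _ x
  exact h

/-! ## §2 The readings on `K_v`: `ℤ_p` is rigid, so D1's `hΘe` forces `θ|_{K_v}` to be the canonical `K_v = ℚ_p ⊆ ℂ_p` -/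

/-- **`ℤ_p` has no ring endomorphism but the identity.** [folklore] -/
theorem ringHom_padicInt_eq_id {p : ℕ} [Fact p.Prime] (f : ℤ_[p] →+* ℤ_[p]) : f = RingHom.id ℤ_[p] := by
  refine PadicInt.toZModPow_eq_iff_ext.mp fun n ↦ ?_
  ext x
  -- `x = z + p^n y` with `z` the canonical lift of `x mod p^n`
  change PadicInt.toZModPow n (f x) = PadicInt.toZModPow n x
  have hker : x - ((PadicInt.toZModPow n x).val : ℤ_[p]) ∈ RingHom.ker (PadicInt.toZModPow n) := by
    rw [RingHom.mem_ker, map_sub, map_natCast, ZMod.natCast_zmod_val, sub_self]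
  rw [PadicInt.ker_toZModPow, Ideal.mem_span_singleton] at hker
  obtain ⟨y, hy⟩ := hker
  have hx : x = ((PadicInt.toZModPow n x).val : ℤ_[p]) + (p : ℤ_[p]) ^ n * y := by
    rw [← hy]; ring
  conv_lhs => rw [hx]
  simp only [map_add, map_mul, map_pow, map_natCast]
  have hp0 : ((p : ZMod (p ^ n)) ^ n) = 0 := by rw [← Nat.cast_pow, ZMod.natCast_self]
  rw [hp0, zero_mul, add_zero, ZMod.natCast_zmod_val]

/-- **A ring isomorphism `𝒪_v ≃ ℤ_p` is THE canonical one** (`padicIntEquivOfDegreeOne`), by the rigidity of `ℤ_p`.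
[cite: FrohlichTaylor1990, Ch. III §1 (1.14)(a)] -/
theorem ringEquiv_eq_padicIntEquivOfDegreeOne {p : ℕ} [Fact p.Prime] {K : Type} [Field K] [NumberField K]
    {v : HeightOneSpectrum (𝓞 K)} [v.asIdeal.LiesOver (ratPlace p).asIdeal]
    (he : v.asIdeal.ramificationIdx (𝓞 ℚ) = 1) (hf : v.asIdeal.inertiaDeg (𝓞 ℚ) = 1)
    (e₂ : v.adicCompletionIntegers K ≃+* ℤ_[p]) (a : v.adicCompletionIntegers K) :
    e₂ a = padicIntEquivOfDegreeOne K p v he hf a := by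
  have h := ringHom_padicInt_eq_id ((e₂ : v.adicCompletionIntegers K →+* ℤ_[p]).comp
    (padicIntEquivOfDegreeOne K p v he hf).symm.toRingHom)
  have := congrArg (fun g : ℤ_[p] →+* ℤ_[p] ↦ g (padicIntEquivOfDegreeOne K p v he hf a)) h
  simpa using this

/-- **D1's `hΘe` pins `θ` on `K_v`**: `θ(a) = a` read through `K_v ≅ ℚ_p ⊆ ℂ_p` for every `a ∈ K_v` (two ring maps `K_v → ℂ_p` agreeing on
`𝒪[K_v]`, a fraction ring; on `𝒪[K_v]` by `hΘe` and the rigidity of `ℤ_p`). [cite: FrohlichTaylor1990, Ch. III §1 (1.14)(a)] -/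
theorem theta_algebraMap_eq {p : ℕ} [Fact p.Prime] {K : Type} [Field K] [NumberField K]
    {v : HeightOneSpectrum (𝓞 K)} [v.asIdeal.LiesOver (ratPlace p).asIdeal]
    (he : v.asIdeal.ramificationIdx (𝓞 ℚ) = 1) (hf : v.asIdeal.inertiaDeg (𝓞 ℚ) = 1)
    (θ : CompletedAlgClosure (v.adicCompletion K) →+* ℂ_[p]) (e₂ : v.adicCompletionIntegers K ≃+* ℤ_[p])
    (hΘe : ∀ a : 𝒪[v.adicCompletion K], (θ.comp ((CBall (v.adicCompletion K)).subtype.comp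
        (algebraMap (UnrCoeff (v.adicCompletion K)) (CBall (v.adicCompletion K))))) (intToUnrCoeff (v.adicCompletion K) a) =
      padicIntCast ℂ_[p] (((e₂ : v.adicCompletionIntegers K →+* ℤ_[p]).comp (integerEquivAdicCompletionIntegers v).toRingHom) a))
    (a : v.adicCompletion K) :
    θ (algebraMap (v.adicCompletion K) (CompletedAlgClosure (v.adicCompletion K)) a) =
      algebraMap ℚ_[p] ℂ_[p] (padicEquivOfDegreeOne K p v he hf a) := by
  -- on `𝒪[K_v]`: `hΘe` and the rigidity of `ℤ_p`
  have key : ∀ b : 𝒪[v.adicCompletion K],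
      θ (algebraMap (v.adicCompletion K) (CompletedAlgClosure (v.adicCompletion K)) (b : v.adicCompletion K)) =
        algebraMap ℚ_[p] ℂ_[p] (padicEquivOfDegreeOne K p v he hf (b : v.adicCompletion K)) := by
    intro b
    have h1 := hΘe b
    simp only [RingHom.comp_apply, Subring.coe_subtype, coe_algebraMap_intToUnrCoeff] at h1
    rw [h1, padicIntCast_apply, RingEquiv.toRingHom_eq_coe, RingHom.coe_coe, RingHom.coe_coe,
      ringEquiv_eq_padicIntEquivOfDegreeOne he hf e₂, coe_padicIntEquivOfDegreeOne_apply, coe_integerEquivAdicCompletionIntegers]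
  -- extend to `K_v = Frac 𝒪[K_v]`
  have hext : θ.comp (algebraMap (v.adicCompletion K) (CompletedAlgClosure (v.adicCompletion K))) =
      (algebraMap ℚ_[p] ℂ_[p]).comp (padicEquivOfDegreeOne K p v he hf).toRingHom :=
    IsLocalization.ringHom_ext (nonZeroDivisors 𝒪[v.adicCompletion K]) (RingHom.ext fun b ↦ by
      change θ (algebraMap (v.adicCompletion K) (CompletedAlgClosure (v.adicCompletion K)) (b : v.adicCompletion K)) =
        algebraMap ℚ_[p] ℂ_[p] (padicEquivOfDegreeOne K p v he hf (b : v.adicCompletion K))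
      exact key b)
  have := congrArg (fun g : v.adicCompletion K →+* ℂ_[p] ↦ g a) hext
  simpa only [RingHom.comp_apply, RingEquiv.toRingHom_eq_coe, RingHom.coe_coe] using this

/-! ## §3 The conjugacy of the two readings of `K̄` -/

/-- ★★ **Q-θ: the `p`-adic and the complex readings of `K̄` agree up to ONE `τ ∈ Γ_K`.**  For `K` a number field, `v` of degree one
above `p`, `θ : ℂ_{K_v} → ℂ_p` a ring map with D1's `hΘe` (for some `e₂ : 𝒪_v ≃ ℤ_p`), `ι_p : ℚ̄_p ≃ ℂ` and `σ : K → ℂ` inducing `v`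
through `ι_p` (the endpoint's `hι`): there is `τ ∈ Gal(K̄/K)` with
`θ (algClosureToC (absClosureEmbedding K K_v (τ x))) = ι_p⁻¹ (algClosureEmb σ x)` in `ℂ_p` for every `x ∈ K̄` — the lane's embedding
`K̄ → K̄_v → ℂ_{K_v}` read through `θ` IS the complex embedding read through `ι_p⁻¹`, after the automorphism `τ`.
[cite: SerreAbelianLadic1968, Ch. II §3.1, Ch. III §1.1] [cite: deShalit1987, II.4.7 (p. 60)] -/
theorem exists_absGal_reading_conj {p : ℕ} [Fact p.Prime] {K : Type} [Field K] [NumberField K]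
    {v : HeightOneSpectrum (𝓞 K)} [v.asIdeal.LiesOver (ratPlace p).asIdeal]
    (he : v.asIdeal.ramificationIdx (𝓞 ℚ) = 1) (hf : v.asIdeal.inertiaDeg (𝓞 ℚ) = 1)
    (θ : CompletedAlgClosure (v.adicCompletion K) →+* ℂ_[p]) (e₂ : v.adicCompletionIntegers K ≃+* ℤ_[p])
    (hΘe : ∀ a : 𝒪[v.adicCompletion K], (θ.comp ((CBall (v.adicCompletion K)).subtype.comp
        (algebraMap (UnrCoeff (v.adicCompletion K)) (CBall (v.adicCompletion K))))) (intToUnrCoeff (v.adicCompletion K) a) =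
      padicIntCast ℂ_[p] (((e₂ : v.adicCompletionIntegers K →+* ℤ_[p]).comp (integerEquivAdicCompletionIntegers v).toRingHom) a))
    (ιp : PadicAlgCl p ≃+* ℂ) (σ : K →+* ℂ) (hισ : ∀ d : 𝓞 K, d ∈ v.asIdeal ↔ ‖ιp.symm (σ (d : K))‖ < 1) :
    ∃ τ : absoluteGaloisGroup K, ∀ x : AlgebraicClosure K,
      θ (algClosureToC (v.adicCompletion K) (absClosureEmbedding K (v.adicCompletion K) (τ • x))) =
        algebraMap (PadicAlgCl p) ℂ_[p] (ιp.symm (algClosureEmb σ x)) := by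
  -- the common reading `φ₀ : K → ℂ_p` through `K_v = ℚ_p ⊆ ℚ̄_p ⊆ ℂ_p`
  let φ₀ : K →+* ℂ_[p] := (algebraMap (PadicAlgCl p) ℂ_[p]).comp
    ((((algebraMap ℚ_[p] (PadicAlgCl p)).comp (padicEquivOfDegreeOne K p v he hf).toRingHom).comp
      (algebraMap K (v.adicCompletion K))))
  letI : Algebra K ℂ_[p] := φ₀.toAlgebra
  -- the p-adic reading as a `K`-algebra map
  have h₁ : ∀ k : K, θ (algClosureToC (v.adicCompletion K) (absClosureEmbedding K (v.adicCompletion K)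
      (algebraMap K (AlgebraicClosure K) k))) = φ₀ k := by
    intro k
    rw [AlgHom.commutes, IsScalarTower.algebraMap_apply K (v.adicCompletion K) (AlgebraicClosure (v.adicCompletion K)),
      algClosureToC_algebraMap, theta_algebraMap_eq he hf θ e₂ hΘe]
    change _ = algebraMap (PadicAlgCl p) ℂ_[p] (algebraMap ℚ_[p] (PadicAlgCl p) (padicEquivOfDegreeOne K p v he hf _))
    rw [← IsScalarTower.algebraMap_apply ℚ_[p] (PadicAlgCl p) ℂ_[p]]
  let φ₁ : AlgebraicClosure K →ₐ[K] ℂ_[p] :=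
    { toRingHom := (θ.comp (algClosureToC (v.adicCompletion K))).comp
        (absClosureEmbedding K (v.adicCompletion K)).toRingHom
      commutes' := fun k ↦ h₁ k }
  -- the complex reading through `ι_p⁻¹` as a `K`-algebra map (`hι` pins it on `K`)
  have hK := AvatarOnRay.comp_eq_of_place_eq ιp he hf σ hισ
  have h₂ : ∀ k : K, algebraMap (PadicAlgCl p) ℂ_[p] (ιp.symm (algClosureEmb σ (algebraMap K (AlgebraicClosure K) k))) =
      φ₀ k := by
    intro k
    rw [algClosureEmb_algebraMap]
    have hk := congrArg (fun g : K →+* ℂ ↦ g k) hK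
    simp only [RingHom.comp_apply] at hk
    change algebraMap (PadicAlgCl p) ℂ_[p] (ιp.symm (σ k)) =
      algebraMap (PadicAlgCl p) ℂ_[p] ((algebraMap ℚ_[p] (PadicAlgCl p)) (padicEquivOfDegreeOne K p v he hf
        (algebraMap K (v.adicCompletion K) k)))
    rw [← hk]
    change algebraMap (PadicAlgCl p) ℂ_[p] (ιp.symm (ιp _)) = _
    rw [RingEquiv.symm_apply_apply]
    rfl
  let φ₂ : AlgebraicClosure K →ₐ[K] ℂ_[p] :=
    { toRingHom := ((algebraMap (PadicAlgCl p) ℂ_[p]).comp (ιp.symm : ℂ ≃+* PadicAlgCl p).toRingHom).comp (algClosureEmb σ)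
      commutes' := fun k ↦ h₂ k }
  obtain ⟨τ, hτ⟩ := exists_algEquiv_forall_apply_eq φ₁ φ₂
  exact ⟨τ, fun x ↦ hτ x⟩

/-- ★★ **Q-θ in the frame of `hseam` / the R3 endpoint** (quadratic `K`, `p = v·v̄` split, D1's `θ, e₂, hΘe`, the endpoint's `hι` at any
infinite place `w₀`): there is `τ ∈ Γ_K` with `θ (algClosureToC (absClosureEmbedding K K_v (τ • x))) = ι_p⁻¹ (algClosureEmb w₀.embedding x)`
for all `x ∈ K̄` — the hypothesis `hQθ`/`hτ` of the seam's per-unit assembler, with `φC := algClosureEmb w₀.embedding ∘ τ⁻¹` resp. the data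
read at `τ • x`. [cite: SerreAbelianLadic1968, Ch. II §3.1, Ch. III §1.1] [cite: deShalit1987, II.4.7 (p. 60)] -/
theorem exists_absGal_reading_conj_of_split {p : ℕ} [Fact p.Prime] {K : Type} [Field K] [NumberField K]
    (hK2 : Module.finrank ℚ K = 2) {v vbar : HeightOneSpectrum (𝓞 K)}
    (hv : ((p : ℕ) : 𝓞 K) ∈ v.asIdeal) (hvbar : ((p : ℕ) : 𝓞 K) ∈ vbar.asIdeal) (hne : vbar ≠ v)
    (θ : CompletedAlgClosure (v.adicCompletion K) →+* ℂ_[p]) (e₂ : v.adicCompletionIntegers K ≃+* ℤ_[p])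
    (hΘe : ∀ a : 𝒪[v.adicCompletion K], (θ.comp ((CBall (v.adicCompletion K)).subtype.comp
        (algebraMap (UnrCoeff (v.adicCompletion K)) (CBall (v.adicCompletion K))))) (intToUnrCoeff (v.adicCompletion K) a) =
      padicIntCast ℂ_[p] (((e₂ : v.adicCompletionIntegers K →+* ℤ_[p]).comp (integerEquivAdicCompletionIntegers v).toRingHom) a))
    (ιp : PadicAlgCl p ≃+* ℂ) (w₀ : InfinitePlace K)
    (hι : ∀ (w : InfinitePlace K) (k : 𝓞 K), k ∈ v.asIdeal ↔ ‖ιp.symm (w.embedding (k : K))‖ < 1) :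
    ∃ τ : absoluteGaloisGroup K, ∀ x : AlgebraicClosure K,
      θ (algClosureToC (v.adicCompletion K) (absClosureEmbedding K (v.adicCompletion K) (τ • x))) =
        algebraMap (PadicAlgCl p) ℂ_[p] (ιp.symm (algClosureEmb w₀.embedding x)) := by
  haveI := liesOver_ratPlace_of_natCast_mem K v hv
  obtain ⟨he, hf⟩ := ramificationIdx_eq_one_and_inertiaDeg_eq_one_of_natCast_mem_of_ne K hK2 hv hvbar hne
  exact exists_absGal_reading_conj he hf θ e₂ hΘe ιp w₀.embedding (hι w₀)

end Summit.BirchSwinnertonDyer.BirchSwinnertonDyer.Theorems.PrintCf2.KatzMeasureJZeroTop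

end
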